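import Summits.Ventures.HodgeRepro2.T5SU11SphericalODE

/-!
# The integrated radial equation and the Lipschitz bound for the spherical functions of `SU(1,1)`:
`sinh 2t · u'(t) = λ(λ − 2) ∫_0^t sinh 2s · u(s) ds` and `|u'(t)| ≤ (λ(2 − λ)/2) tanh t` for `0 ≤ λ ≤ 2`

Integrating the radial equation of `T5SU11SphericalODE` in its `sinh`-form
(`(sinh 2t · u')' = λ(λ − 2) sinh 2t · u`, `u(t) = sph λ (a_t)`, `u'(0) = 0`) from `0` to `t` gives
**`sinh 2t · u'(t) = λ(λ − 2) ∫_0^t sinh 2s · u(s) ds`** (`sinh_mul_deriv_eq_integral`). For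
`0 ≤ λ ≤ 2` the integrand lies between `0` and `sinh 2s` (`0 < u ≤ 1`, rows 238), and
`∫_0^t sinh 2s ds = (cosh 2t − 1)/2` (`integral_sinh_two_mul`), so
**`|u'(t)| ≤ (λ(2 − λ)/2) · tanh t ≤ λ(2 − λ)/2 ≤ 1/2`** for `t ≥ 0` (`abs_deriv_sph_hyp_le_tanh`,
`abs_deriv_sph_hyp_le`; by evenness for every `t`, `abs_deriv_sph_hyp_le'`), hence
**`t ↦ sph λ (a_t)` is Lipschitz with constant `λ(2 − λ)/2`** (`lipschitzWith_sph_hyp`,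
`abs_sph_hyp_sub_le`) and on the group **`|sph λ g − sph λ h| ≤ (λ(2 − λ)/2) |cartanT g − cartanT h|`**
(`abs_sph_sub_le`); for Harish-Chandra's `Ξ`: `|Ξ(a_t) − Ξ(a_s)| ≤ |t − s|/2` (`abs_sph_one_hyp_sub_le`).
Nothing is claimed about (N).

Blind lane: Mathlib + the HodgeRepro2 prefix only; no sorry; axioms ⊆ {propext, Classical.choice,
Quot.sound}.
-/

namespace Summit.Ventures.HodgeRepro2.T5SU11SphericalLipschitz

open MeasureTheory Metric Set Filter Topology Complex intervalIntegral
open T5SU11Unimodular T5SU11Fibration T5SU11Cartan T5SU11OneParameter T5SU11CartanProjection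
  T5HaarCircle T5BergmanCoefficient T5SU11SphericalFunction T5SU11SphericalTwo
  T5SU11SphericalSymmetry T5SU11SphericalBounds T5SU11SphericalContinuous
  T5SU11SphericalAsymptotic T5SU11SphericalLp T5SU11SphericalCfun T5SU11SphericalLpSharp
  T5SU11SphericalXiLog T5SU11SphericalCfunLimit T5SU11SphericalStrict T5SU11SphericalDeriv
  T5SU11SphericalODE
open scoped Real NNReal

/-! ### Elementary integrals and identities -/

/-- `∫_0^t sinh 2s ds = (cosh 2t − 1)/2`. -/
lemma integral_sinh_two_mul (t : ℝ) :
    ∫ s in (0 : ℝ)..t, Real.sinh (2 * s) = (Real.cosh (2 * t) - 1) / 2 := by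
  have hd : ∀ s ∈ uIcc (0 : ℝ) t, HasDerivAt (fun s => Real.cosh (2 * s) / 2) (Real.sinh (2 * s)) s := by
    intro s _
    have h2 : HasDerivAt (fun s : ℝ => 2 * s) 2 s := by
      simpa using (hasDerivAt_id' (x := s)).const_mul (2 : ℝ)
    exact (h2.cosh.div_const 2).congr_deriv (by ring)
  rw [integral_eq_sub_of_hasDerivAt hd
    ((by fun_prop : Continuous fun s => Real.sinh (2 * s)).intervalIntegrable 0 t)]
  simp only [mul_zero, Real.cosh_zero]
  ring

/-- `cosh 2t − 1 = sinh 2t · tanh t`. -/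
lemma cosh_two_mul_sub_one (t : ℝ) : Real.cosh (2 * t) - 1 = Real.sinh (2 * t) * Real.tanh t := by
  have hc : Real.cosh t ≠ 0 := (Real.cosh_pos t).ne'
  rw [Real.cosh_two_mul, Real.sinh_two_mul, Real.tanh_eq_sinh_div_cosh, Real.cosh_sq,
    show 2 * Real.sinh t * Real.cosh t * (Real.sinh t / Real.cosh t) =
      2 * Real.sinh t * Real.sinh t * (Real.cosh t / Real.cosh t) by ring, div_self hc]
  ring

/-- `0 ≤ tanh t` for `t ≥ 0`. -/
lemma tanh_nonneg {t : ℝ} (ht : 0 ≤ t) : 0 ≤ Real.tanh t := by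
  rw [Real.tanh_eq_sinh_div_cosh]
  exact div_nonneg (Real.sinh_nonneg_iff.mpr ht) (Real.cosh_pos t).le

section measure

variable [MeasurableSpace Circle] [BorelSpace Circle]

/-- `s ↦ sinh 2s · sph λ (a_s)` is continuous. -/
lemma continuous_sinh_mul_sph_hyp (lam : ℝ) :
    Continuous fun s => Real.sinh (2 * s) * sph lam (hyp s) :=
  (by fun_prop : Continuous fun s : ℝ => Real.sinh (2 * s)).mul (continuous_sph_hyp lam)

/-- **The integrated radial equation**:
`sinh 2t · u'(t) = λ(λ − 2) ∫_0^t sinh 2s · sph λ (a_s) ds` for `u(t) = sph λ (a_t)`. -/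
theorem sinh_mul_deriv_eq_integral (lam t : ℝ) :
    Real.sinh (2 * t) * deriv (fun t => sph lam (hyp t)) t =
      lam * (lam - 2) * ∫ s in (0 : ℝ)..t, Real.sinh (2 * s) * sph lam (hyp s) := by
  obtain ⟨u', u'', hu', hu'', hode⟩ := exists_hasDerivAt_sph_hyp_ode lam
  have hderiv : deriv (fun t => sph lam (hyp t)) = u' := funext fun t => (hu' t).deriv
  rw [hderiv]
  have hw : ∀ s, HasDerivAt (fun s => Real.sinh (2 * s) * u' s)
      (lam * (lam - 2) * Real.sinh (2 * s) * sph lam (hyp s)) s := by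
    intro s
    have h2 : HasDerivAt (fun s : ℝ => 2 * s) 2 s := by
      simpa using (hasDerivAt_id' (x := s)).const_mul (2 : ℝ)
    refine (h2.sinh.mul (hu'' s)).congr_deriv ?_
    linear_combination hode s
  have hint : ∫ s in (0 : ℝ)..t, lam * (lam - 2) * Real.sinh (2 * s) * sph lam (hyp s) =
      Real.sinh (2 * t) * u' t - Real.sinh (2 * 0) * u' 0 :=
    integral_eq_sub_of_hasDerivAt (fun s _ => hw s)
      (((continuous_sinh_mul_sph_hyp lam).const_mul (lam * (lam - 2))).congr
        (fun s => by ring) |>.intervalIntegrable _ _)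
  rw [mul_zero, Real.sinh_zero, zero_mul, sub_zero] at hint
  rw [← hint, ← intervalIntegral.integral_const_mul]
  congr 1
  funext s
  ring

/-- **The basic bound**: for `0 ≤ λ ≤ 2` and `t ≥ 0`,
`|sinh 2t · u'(t)| ≤ (λ(2 − λ)/2) (cosh 2t − 1)`. -/
theorem abs_sinh_mul_deriv_le {lam : ℝ} (h0 : 0 ≤ lam) (h2 : lam ≤ 2) {t : ℝ} (ht : 0 ≤ t) :
    |Real.sinh (2 * t) * deriv (fun t => sph lam (hyp t)) t| ≤
      lam * (2 - lam) / 2 * (Real.cosh (2 * t) - 1) := by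
  rw [sinh_mul_deriv_eq_integral]
  have hI0 : 0 ≤ ∫ s in (0 : ℝ)..t, Real.sinh (2 * s) * sph lam (hyp s) :=
    integral_nonneg ht fun s hs =>
      mul_nonneg (Real.sinh_nonneg_iff.mpr (by linarith [hs.1])) (sph_hyp_pos lam s).le
  have hI1 : ∫ s in (0 : ℝ)..t, Real.sinh (2 * s) * sph lam (hyp s) ≤
      ∫ s in (0 : ℝ)..t, Real.sinh (2 * s) := by
    refine integral_mono_on ht ((continuous_sinh_mul_sph_hyp lam).intervalIntegrable _ _)
      ((by fun_prop : Continuous fun s : ℝ => Real.sinh (2 * s)).intervalIntegrable _ _)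
      fun s hs => ?_
    have hsh : 0 ≤ Real.sinh (2 * s) := Real.sinh_nonneg_iff.mpr (by linarith [hs.1])
    calc Real.sinh (2 * s) * sph lam (hyp s) ≤ Real.sinh (2 * s) * 1 :=
          mul_le_mul_of_nonneg_left (sph_hyp_le_one h0 h2 s) hsh
      _ = Real.sinh (2 * s) := mul_one _
  rw [integral_sinh_two_mul] at hI1
  have hl : lam * (lam - 2) ≤ 0 := mul_nonpos_of_nonneg_of_nonpos h0 (by linarith)
  rw [abs_of_nonpos (mul_nonpos_of_nonpos_of_nonneg hl hI0)]
  nlinarith [mul_le_mul_of_nonneg_left hI1 (neg_nonneg.mpr hl)]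

/-- **The Lipschitz bound on `[0, ∞)`**: `|u'(t)| ≤ (λ(2 − λ)/2) tanh t` for `0 ≤ λ ≤ 2`, `t ≥ 0`. -/
theorem abs_deriv_sph_hyp_le_tanh {lam : ℝ} (h0 : 0 ≤ lam) (h2 : lam ≤ 2) {t : ℝ} (ht : 0 ≤ t) :
    |deriv (fun t => sph lam (hyp t)) t| ≤ lam * (2 - lam) / 2 * Real.tanh t := by
  rcases ht.lt_or_eq with ht' | rfl
  · have hs : 0 < Real.sinh (2 * t) := Real.sinh_pos_iff.mpr (by linarith)
    have h := abs_sinh_mul_deriv_le h0 h2 ht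
    rw [abs_mul, abs_of_pos hs, cosh_two_mul_sub_one] at h
    have : Real.sinh (2 * t) * |deriv (fun t => sph lam (hyp t)) t| ≤
        Real.sinh (2 * t) * (lam * (2 - lam) / 2 * Real.tanh t) := by
      calc Real.sinh (2 * t) * |deriv (fun t => sph lam (hyp t)) t|
          ≤ lam * (2 - lam) / 2 * (Real.sinh (2 * t) * Real.tanh t) := h
        _ = Real.sinh (2 * t) * (lam * (2 - lam) / 2 * Real.tanh t) := by ring
    exact le_of_mul_le_mul_left this hs
  · rw [deriv_sph_hyp_zero, abs_zero, Real.tanh_zero, mul_zero]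

/-- **`|u'(t)| ≤ λ(2 − λ)/2` for `t ≥ 0`.** -/
theorem abs_deriv_sph_hyp_le {lam : ℝ} (h0 : 0 ≤ lam) (h2 : lam ≤ 2) {t : ℝ} (ht : 0 ≤ t) :
    |deriv (fun t => sph lam (hyp t)) t| ≤ lam * (2 - lam) / 2 :=
  (abs_deriv_sph_hyp_le_tanh h0 h2 ht).trans
    (mul_le_of_le_one_right (by nlinarith) (Real.tanh_lt_one t).le)

/-- `u'(-t) = -u'(t)`: the derivative of the even function `t ↦ sph λ (a_t)` is odd. -/
theorem deriv_sph_hyp_neg_arg (lam t : ℝ) :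
    deriv (fun t => sph lam (hyp t)) (-t) = -deriv (fun t => sph lam (hyp t)) t := by
  have h := deriv_comp_neg (f := fun t => sph lam (hyp t)) (x := t)
  have e : (fun x => sph lam (hyp (-x))) = fun t => sph lam (hyp t) := by
    funext x
    exact sph_hyp_neg lam x
  rw [e] at h
  linarith

/-- **`|u'(t)| ≤ λ(2 − λ)/2` for every `t`** (`0 ≤ λ ≤ 2`). -/
theorem abs_deriv_sph_hyp_le' {lam : ℝ} (h0 : 0 ≤ lam) (h2 : lam ≤ 2) (t : ℝ) :
    |deriv (fun t => sph lam (hyp t)) t| ≤ lam * (2 - lam) / 2 := by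
  rcases le_or_gt 0 t with ht | ht
  · exact abs_deriv_sph_hyp_le h0 h2 ht
  · have := abs_deriv_sph_hyp_le h0 h2 (t := -t) (by linarith)
    rwa [deriv_sph_hyp_neg_arg, abs_neg] at this

/-- **`t ↦ sph λ (a_t)` is Lipschitz with constant `λ(2 − λ)/2`** (`0 ≤ λ ≤ 2`). -/
theorem lipschitzWith_sph_hyp {lam : ℝ} (h0 : 0 ≤ lam) (h2 : lam ≤ 2) :
    LipschitzWith (Real.toNNReal (lam * (2 - lam) / 2)) fun t => sph lam (hyp t) := by
  refine lipschitzWith_of_nnnorm_deriv_le (differentiable_sph_hyp lam) fun t => ?_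
  rw [← NNReal.coe_le_coe, coe_nnnorm, Real.coe_toNNReal _ (by nlinarith), Real.norm_eq_abs]
  exact abs_deriv_sph_hyp_le' h0 h2 t

/-- **`|sph λ (a_t) − sph λ (a_s)| ≤ (λ(2 − λ)/2) |t − s|`** (`0 ≤ λ ≤ 2`). -/
theorem abs_sph_hyp_sub_le {lam : ℝ} (h0 : 0 ≤ lam) (h2 : lam ≤ 2) (t s : ℝ) :
    |sph lam (hyp t) - sph lam (hyp s)| ≤ lam * (2 - lam) / 2 * |t - s| := by
  have h := (lipschitzWith_sph_hyp h0 h2).dist_le_mul t s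
  rwa [Real.dist_eq, Real.dist_eq, Real.coe_toNNReal _ (by nlinarith)] at h

/-- **On the group**: `|sph λ g − sph λ h| ≤ (λ(2 − λ)/2) |cartanT g − cartanT h|` (`0 ≤ λ ≤ 2`). -/
theorem abs_sph_sub_le {lam : ℝ} (h0 : 0 ≤ lam) (h2 : lam ≤ 2) (g h : SU11) :
    |sph lam g - sph lam h| ≤ lam * (2 - lam) / 2 * |cartanT g - cartanT h| := by
  rw [sph_eq_sph_hyp_cartanT lam g, sph_eq_sph_hyp_cartanT lam h]
  exact abs_sph_hyp_sub_le h0 h2 _ _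

/-- **Harish-Chandra's `Ξ` is `1/2`-Lipschitz in the Cartan parameter**:
`|Ξ(a_t) − Ξ(a_s)| ≤ |t − s| / 2`. -/
theorem abs_sph_one_hyp_sub_le (t s : ℝ) : |sph 1 (hyp t) - sph 1 (hyp s)| ≤ |t - s| / 2 := by
  have := abs_sph_hyp_sub_le zero_le_one one_le_two t s
  norm_num at this
  linarith

end measure

end Summit.Ventures.HodgeRepro2.T5SU11SphericalLipschitz
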